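import Summits.CriticalPhenomena.PercolationContinuityZ3.Theorems.PercNearOneGluingNoHeavyLowerTailAntitheticCliqueApexZones
import HarnessLib

/-!
# `NoHeavyLowerTail` (stmt-CriticalPhenomena-4575) — antithetic cluster pairs: THEOREM J — BIC({c}) for the apex `c` of a spoked clique
# (part 2: zone invariance, the piece sum, the theorem; prim-hp-2 gen 36, MEMO-gen36 §4f)

Support file (`--supports stmt-CriticalPhenomena-4575`, hull-port prover `prim-hp-2`, gen 36).  No definitions, no named facts, no sorries;
standard axioms.  See `…AntitheticCliqueApexZones` for the setting, the rule and the key fact.  Here: the zone of every member of a part equals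
the zone of the part's generator (`Apex.zoneJ_eq_of_mem`: cases reached/unreached × block up/down, cluster congruence and the monochromatic
edges at an unreached `c`), the part is `{N △ A}` over the two-atom block algebra with a sealing-valid top (`Apex.partJ_sum_nonneg`), and
THEOREM J `Antithetic.bic_cliqueApex_nonneg` follows from the partition principle.
[cite: VandenbergHaggstromKahn2005, §1 p. 6 ("Harris' inequality"), §1 p. 3 (open cluster `C_s`)]
-/

noncomputable section

namespace Summit.CriticalPhenomena.PercolationContinuityZ3.Theorems

open Literature.Probability.Percolation
open scoped Classical symmDiff

namespace Antithetic

namespace Apex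

section Lemmas

variable {V : Type*} {E : Set (Sym2 V)} {s c : V} {T : Set (Sym2 V)}

/-- **Zone invariance, red-reached case.** [this work] -/
theorem zoneJ_eq_of_mem_red [Fintype V] (hcs : c ≠ s) (hN : ∀ u, s(c, u) ∈ E → u ≠ c → s(s, u) ∈ E)
    (hK : ∀ u v, s(c, u) ∈ E → s(c, v) ∈ E → u ≠ c → v ≠ c → u ≠ v → s(u, v) ∈ E)
    (hr : (openGraph (T ∩ E)).Reachable s c) (hb : ¬ (openGraph (Tᶜ ∩ E)).Reachable s c) {M : Set (Sym2 V)}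
    (hM : M ∈ partJ E s c T) : zoneJ E s c M = zoneJ E s c T := by
  have hT : ¬ ((openGraph (T ∩ E)).Reachable s c ∧ (openGraph (Tᶜ ∩ E)).Reachable s c) := fun h => hb h.2
  have hMD := mem_constraint_of_mem_partJ hcs hN hK hT hM
  rw [partJ, Finset.mem_filter] at hM
  have hZT := zoneJ_eq_of_red hr hb
  -- the singleton sub-case: if c is unreached in M then all c-edges are monochromatic in M, hence in T, hence red; zone = {c}
  have single : ¬ (openGraph (M ∩ E)).Reachable s c → ¬ (openGraph (Mᶜ ∩ E)).Reachable s c →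
      zoneJ E s c M = zoneJ E s c T := by
    intro hr' hb'
    rw [zoneJ_eq_of_none hr' hb', hZT]
    obtain ⟨u₀, hu₀E, hu₀c, hu₀T⟩ := exists_red_edge hcs hr
    have hcblk : ∀ u, s(c, u) ∈ E → s(c, u) ∈ blkJ E s c T := fun u hu => ⟨hu, c, mem_zoneJ_self, Sym2.mem_mk_left c u⟩
    have hmT : ∀ u, s(c, u) ∈ E → u ≠ c → s(c, u) ∈ T := by
      rcases mono_of_unreached hcs hN hK hr' hb' with hm | hm
      · rcases hM.2 with h | h
        · exact fun u hu huc => (h _ (hcblk u hu)).1 (hm u hu huc)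
        · exact fun u hu huc => absurd hu₀T ((h _ (hcblk u₀ hu₀E)).1 (hm u₀ hu₀E hu₀c))
      · rcases hM.2 with h | h
        · exact fun u hu huc => absurd ((h _ (hcblk u₀ hu₀E)).2 hu₀T) (hm u₀ hu₀E hu₀c)
        · intro u hu huc
          by_contra hut
          exact hm u hu huc ((h _ (hcblk u hu)).2 hut)
    exact (blueCluster_eq_singleton hmT).symm
  rcases hM.2 with h | h
  · -- M agrees with T on the block: the boundary is red in M, c is not blue-reached
    by_cases hr' : (openGraph (M ∩ E)).Reachable s c
    · have hb' : ¬ (openGraph (Mᶜ ∩ E)).Reachable s c := fun h' => hMD ⟨hr', h'⟩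
      rw [zoneJ_eq_of_red hr' hb', hZT]
      refine openCluster_eq_of_agree (Tᶜ ∩ E) (Mᶜ ∩ E) c fun x hx y => ?_
      by_cases hE : s(x, y) ∈ E
      · have := h _ ⟨hE, x, by rw [hZT]; exact hx, Sym2.mem_mk_left x y⟩
        simp only [Set.mem_inter_iff, Set.mem_compl_iff, hE, and_true, this]
      · simp only [Set.mem_inter_iff, hE, and_false]
    · by_cases hb' : (openGraph (Mᶜ ∩ E)).Reachable s c
      · -- impossible: boundary red in M seals the zone against blue
        exfalso
        obtain ⟨κ, hκ⟩ := boundary_zoneJ hcs hN hK hT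
        -- κ is True here: the red edge at c... use sealing directly with the boundary of the blue cluster (red in T, = in M)
        refine not_reachable_of_sealed (Mᶜ ∩ E) s _ (s_not_mem_zoneJ hcs hT) (fun x y hx hy hxy => ?_) mem_zoneJ_self hb'
        have hyc : y ∈ openCluster (Tᶜ ∩ E) c := by rw [← hZT]; exact hy
        have hxc : x ∉ openCluster (Tᶜ ∩ E) c := by rw [← hZT]; exact hx
        have hred : s(x, y) ∈ T := by
          by_contra h'
          exact not_mem_of_boundary (Tᶜ ∩ E) c hxc hyc ⟨h', hxy.2⟩
        exact hxy.1 ((h _ ⟨hxy.2, y, hy, Sym2.mem_mk_right x y⟩).2 hred)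
      · exact single hr' hb'
  · -- M agrees with Tᶜ on the block: the boundary is blue in M, c is not red-reached
    have hr' : ¬ (openGraph (M ∩ E)).Reachable s c := by
      refine not_reachable_of_sealed (M ∩ E) s _ (s_not_mem_zoneJ hcs hT) (fun x y hx hy hxy => ?_) mem_zoneJ_self
      have hyc : y ∈ openCluster (Tᶜ ∩ E) c := by rw [← hZT]; exact hy
      have hxc : x ∉ openCluster (Tᶜ ∩ E) c := by rw [← hZT]; exact hx
      have hred : s(x, y) ∈ T := by
        by_contra h'
        exact not_mem_of_boundary (Tᶜ ∩ E) c hxc hyc ⟨h', hxy.2⟩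
      exact (h _ ⟨hxy.2, y, hy, Sym2.mem_mk_right x y⟩).1 hxy.1 hred
    by_cases hb' : (openGraph (Mᶜ ∩ E)).Reachable s c
    · have hZM : zoneJ E s c M = openCluster (M ∩ E) c := by
        rw [← zoneJ_compl]
        rw [zoneJ_eq_of_red (T := Mᶜ) hb' (by rwa [compl_compl]), compl_compl]
      rw [hZM, hZT]
      refine openCluster_eq_of_agree (Tᶜ ∩ E) (M ∩ E) c fun x hx y => ?_
      by_cases hE : s(x, y) ∈ E
      · have := h _ ⟨hE, x, by rw [hZT]; exact hx, Sym2.mem_mk_left x y⟩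
        simp only [Set.mem_inter_iff, Set.mem_compl_iff, hE, and_true, this]
      · simp only [Set.mem_inter_iff, hE, and_false]
    · exact single hr' hb'

/-- **Zone invariance** (all cases). [this work] -/
theorem zoneJ_eq_of_mem [Fintype V] (hcs : c ≠ s) (hN : ∀ u, s(c, u) ∈ E → u ≠ c → s(s, u) ∈ E)
    (hK : ∀ u v, s(c, u) ∈ E → s(c, v) ∈ E → u ≠ c → v ≠ c → u ≠ v → s(u, v) ∈ E)
    (hT : ¬ ((openGraph (T ∩ E)).Reachable s c ∧ (openGraph (Tᶜ ∩ E)).Reachable s c)) {M : Set (Sym2 V)}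
    (hM : M ∈ partJ E s c T) : zoneJ E s c M = zoneJ E s c T := by
  by_cases hr : (openGraph (T ∩ E)).Reachable s c
  · exact zoneJ_eq_of_mem_red hcs hN hK hr (fun h => hT ⟨hr, h⟩) hM
  · by_cases hb : (openGraph (Tᶜ ∩ E)).Reachable s c
    · -- apply the red case to Tᶜ
      rw [← zoneJ_compl (T := T)]
      rw [← partJ_compl (T := T)] at hM
      exact zoneJ_eq_of_mem_red hcs hN hK (T := Tᶜ) hb (by rwa [compl_compl]) hM
    · -- c unreached in T: zone {c}; the c-edges are monochromatic in T and in M, so the zone of M is {c} too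
      have hMD := mem_constraint_of_mem_partJ hcs hN hK hT hM
      rw [partJ, Finset.mem_filter] at hM
      rw [zoneJ_eq_of_none hr hb]
      have hcblk : ∀ u, s(c, u) ∈ E → s(c, u) ∈ blkJ E s c T := fun u hu => ⟨hu, c, mem_zoneJ_self, Sym2.mem_mk_left c u⟩
      have hmono : (∀ u, s(c, u) ∈ E → u ≠ c → s(c, u) ∈ M) ∨ (∀ u, s(c, u) ∈ E → u ≠ c → s(c, u) ∉ M) := by
        rcases mono_of_unreached hcs hN hK hr hb with hm | hm <;> rcases hM.2 with h | h
        · exact Or.inl fun u hu huc => (h _ (hcblk u hu)).2 (hm u hu huc)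
        · exact Or.inr fun u hu huc hM' => hm u hu huc |> fun h1 => ((h _ (hcblk u hu)).1 hM') h1
        · exact Or.inr fun u hu huc hM' => hm u hu huc ((h _ (hcblk u hu)).1 hM')
        · exact Or.inl fun u hu huc => (h _ (hcblk u hu)).2 (hm u hu huc)
      by_cases hr' : (openGraph (M ∩ E)).Reachable s c
      · have hb' : ¬ (openGraph (Mᶜ ∩ E)).Reachable s c := fun h' => hMD ⟨hr', h'⟩
        rw [zoneJ_eq_of_red hr' hb']
        obtain ⟨u₀, hu₀E, hu₀c, hu₀M⟩ := exists_red_edge hcs hr'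
        have hm : ∀ u, s(c, u) ∈ E → u ≠ c → s(c, u) ∈ M := by
          rcases hmono with hm | hm
          · exact hm
          · exact absurd hu₀M (hm u₀ hu₀E hu₀c)
        exact blueCluster_eq_singleton hm
      · by_cases hb' : (openGraph (Mᶜ ∩ E)).Reachable s c
        · rw [← zoneJ_compl, zoneJ_eq_of_red (T := Mᶜ) hb' (by rwa [compl_compl]), compl_compl]
          obtain ⟨u₀, hu₀E, hu₀c, hu₀M⟩ := exists_red_edge hcs (T := Mᶜ) hb'
          have hm : ∀ u, s(c, u) ∈ E → u ≠ c → s(c, u) ∈ Mᶜ := by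
            rcases hmono with hm | hm
            · exact absurd (hm u₀ hu₀E hu₀c) hu₀M
            · exact hm
          have := blueCluster_eq_singleton (T := Mᶜ) hm
          rwa [compl_compl] at this
        · exact zoneJ_eq_of_none hr' hb'

/-- Parts are constant on themselves. [this work] -/
theorem partJ_eq_of_mem [Fintype V] (hcs : c ≠ s) (hN : ∀ u, s(c, u) ∈ E → u ≠ c → s(s, u) ∈ E)
    (hK : ∀ u v, s(c, u) ∈ E → s(c, v) ∈ E → u ≠ c → v ≠ c → u ≠ v → s(u, v) ∈ E)
    (hT : ¬ ((openGraph (T ∩ E)).Reachable s c ∧ (openGraph (Tᶜ ∩ E)).Reachable s c)) {M : Set (Sym2 V)}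
    (hM : M ∈ partJ E s c T) : partJ E s c M = partJ E s c T := by
  have hZ := zoneJ_eq_of_mem hcs hN hK hT hM
  have hblk : blkJ E s c M = blkJ E s c T := by simp only [blkJ, hZ]
  rw [partJ, Finset.mem_filter] at hM
  ext X
  simp only [partJ, Finset.mem_filter, Finset.mem_univ, true_and, hblk]
  rcases hM.2 with h | h
  · have h1 : (∀ e ∈ blkJ E s c T, (e ∈ X ↔ e ∈ M)) ↔ (∀ e ∈ blkJ E s c T, (e ∈ X ↔ e ∈ T)) :=
      forall₂_congr fun e he => iff_congr Iff.rfl (h e he)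
    have h2 : (∀ e ∈ blkJ E s c T, (e ∈ X ↔ e ∉ M)) ↔ (∀ e ∈ blkJ E s c T, (e ∈ X ↔ e ∉ T)) :=
      forall₂_congr fun e he => iff_congr Iff.rfl (not_congr (h e he))
    rw [h1, h2]
  · have h1 : (∀ e ∈ blkJ E s c T, (e ∈ X ↔ e ∈ M)) ↔ (∀ e ∈ blkJ E s c T, (e ∈ X ↔ e ∉ T)) :=
      forall₂_congr fun e he => iff_congr Iff.rfl (h e he)
    have h2 : (∀ e ∈ blkJ E s c T, (e ∈ X ↔ e ∉ M)) ↔ (∀ e ∈ blkJ E s c T, (e ∈ X ↔ e ∈ T)) :=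
      forall₂_congr fun e he => iff_congr Iff.rfl (by rw [h e he, not_not])
    rw [h1, h2, or_comm]

/-- `T` lies in its own part. [this work] -/
theorem mem_partJ_self [Fintype V] : T ∈ partJ E s c T := by
  rw [partJ, Finset.mem_filter]
  exact ⟨Finset.mem_univ _, Or.inl fun _ _ => Iff.rfl⟩

/-- **Every part has a nonnegative antithetic sum** (the part is `{N △ A}` over the two-atom block algebra; validity by sealing).
[this work] -/
theorem partJ_sum_nonneg [Fintype V] (hcs : c ≠ s) (hN : ∀ u, s(c, u) ∈ E → u ≠ c → s(s, u) ∈ E)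
    (hK : ∀ u v, s(c, u) ∈ E → s(c, v) ∈ E → u ≠ c → v ≠ c → u ≠ v → s(u, v) ∈ E)
    (hT : ¬ ((openGraph (T ∩ E)).Reachable s c ∧ (openGraph (Tᶜ ∩ E)).Reachable s c))
    {F G : Set (Sym2 V) → ℝ} (hF : Monotone F) (hG : Monotone G) :
    0 ≤ ∑ M ∈ partJ E s c T, (F (openEdgeCluster (M ∩ E) s) - F (openEdgeCluster (Mᶜ ∩ E) s)) *
      (G (openEdgeCluster (M ∩ E) s) - G (openEdgeCluster (Mᶜ ∩ E) s)) := by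
  obtain ⟨κ, hκ⟩ := boundary_zoneJ hcs hN hK hT
  set blk := blkJ E s c T with hblk
  set N : Set (Sym2 V) := {e | e ∈ blk → (e ∈ T ↔ κ)} with hNdef
  set alg : Finset (Set (Sym2 V)) := Finset.univ.filter fun A => blk ⊆ A ∨ Disjoint blk A with halg
  have hmemalg : ∀ A, A ∈ alg ↔ blk ⊆ A ∨ Disjoint blk A := fun A => by simp [halg]
  -- the part is the image of the algebra under N △ ·
  have hpart : partJ E s c T = alg.image fun A => N ∆ A := by
    ext M
    rw [partJ, Finset.mem_filter, Finset.mem_image]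
    simp only [Finset.mem_univ, true_and]
    constructor
    · intro hM
      refine ⟨N ∆ M, ?_, symmDiff_symmDiff_cancel_left _ _⟩
      rw [hmemalg]
      rcases hM with h | h
      · by_cases hk : κ
        · right
          rw [Set.disjoint_left]
          intro e he
          rw [Set.mem_symmDiff]
          have h1 : e ∈ N ↔ (e ∈ T ↔ κ) := ⟨fun hn => hn he, fun h' _ => h'⟩
          have := h e he
          tauto
        · left
          intro e he
          rw [Set.mem_symmDiff]
          have h1 : e ∈ N ↔ (e ∈ T ↔ κ) := ⟨fun hn => hn he, fun h' _ => h'⟩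
          have := h e he
          tauto
      · by_cases hk : κ
        · left
          intro e he
          rw [Set.mem_symmDiff]
          have h1 : e ∈ N ↔ (e ∈ T ↔ κ) := ⟨fun hn => hn he, fun h' _ => h'⟩
          have := h e he
          tauto
        · right
          rw [Set.disjoint_left]
          intro e he
          rw [Set.mem_symmDiff]
          have h1 : e ∈ N ↔ (e ∈ T ↔ κ) := ⟨fun hn => hn he, fun h' _ => h'⟩
          have := h e he
          tauto
    · rintro ⟨A, hA, rfl⟩
      rw [hmemalg] at hA
      rcases hA with hA | hA
      · by_cases hk : κ
        · right
          intro e he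
          rw [Set.mem_symmDiff]
          have h1 : e ∈ N ↔ (e ∈ T ↔ κ) := ⟨fun hn => hn he, fun h' _ => h'⟩
          have := hA he
          tauto
        · left
          intro e he
          rw [Set.mem_symmDiff]
          have h1 : e ∈ N ↔ (e ∈ T ↔ κ) := ⟨fun hn => hn he, fun h' _ => h'⟩
          have := hA he
          tauto
      · by_cases hk : κ
        · left
          intro e he
          rw [Set.mem_symmDiff]
          have h1 : e ∈ N ↔ (e ∈ T ↔ κ) := ⟨fun hn => hn he, fun h' _ => h'⟩
          have := Set.disjoint_left.1 hA he
          tauto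
        · right
          intro e he
          rw [Set.mem_symmDiff]
          have h1 : e ∈ N ↔ (e ∈ T ↔ κ) := ⟨fun hn => hn he, fun h' _ => h'⟩
          have := Set.disjoint_left.1 hA he
          tauto
  rw [hpart]
  refine piece_algebra_sum_nonneg E s N alg ?_ ?_ ?_ ?_ ?_ hF hG
  · intro A hA B hB
    rw [hmemalg] at hA hB ⊢
    exact blockAlgebra_inter (Set.univ : Set Unit) (fun _ => blk) (fun _ _ => hA) (fun _ _ => hB) () trivial
  · intro A hA B hB
    rw [hmemalg] at hA hB ⊢
    exact blockAlgebra_union (Set.univ : Set Unit) (fun _ => blk) (fun _ _ => hA) (fun _ _ => hB) () trivial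
  · intro A hA
    rw [hmemalg] at hA ⊢
    exact blockAlgebra_compl (Set.univ : Set Unit) (fun _ => blk) (fun _ _ => hA) () trivial
  · rw [hmemalg]
    exact Or.inr (Set.disjoint_empty _)
  · -- validity: sealing of the zone when the block is down in N △ B
    intro A hA B hB hAB
    rw [hmemalg] at hB
    set J : Set V := {v | blk ⊆ B ∧ v ∈ zoneJ E s c T} with hJ
    have hsJ : s ∉ J := fun h => s_not_mem_zoneJ hcs hT h.2
    refine openEdgeCluster_subset_of_sealed_le _ _ s J hsJ ?_ ?_
    · intro x y hx hy hxy
      refine ⟨?_, hxy.2⟩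
      have heB := hxy.1
      rw [Set.mem_symmDiff] at heB ⊢
      by_cases heA : s(x, y) ∈ A
      · exact Or.inr ⟨heA, fun hn => by rcases heB with ⟨_, h⟩ | ⟨_, h⟩ <;> [exact h (hAB heA); exact h hn]⟩
      · by_cases heB' : s(x, y) ∈ B
        · exfalso
          have hnN : s(x, y) ∉ N := by
            rcases heB with ⟨_, h⟩ | ⟨_, h⟩
            · exact absurd heB' h
            · exact h
          have heblk : s(x, y) ∈ blk := by
            by_contra h'
            exact hnN fun h'' => absurd h'' h'
          have hblkB : blk ⊆ B := by
            rcases hB with h | h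
            · exact h
            · exact absurd (Set.disjoint_left.1 h heblk) (not_not.2 heB')
          obtain ⟨-, z, hz, hze⟩ := heblk
          rcases Sym2.mem_iff.1 hze with rfl | rfl
          · exact hx ⟨hblkB, hz⟩
          · exact hy ⟨hblkB, hz⟩
        · rcases heB with ⟨h, _⟩ | ⟨h, _⟩
          · exact Or.inl ⟨h, heA⟩
          · exact absurd h heB'
    · intro x y hx hy hxy
      obtain ⟨hblkB, hyZ⟩ := hy
      have hxZ : x ∉ zoneJ E s c T := fun h => hx ⟨hblkB, h⟩
      have heN : s(x, y) ∈ N := fun _ => hκ x hxZ y hyZ hxy.2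
      have heB : s(x, y) ∈ B := hblkB ⟨hxy.2, y, hyZ, Sym2.mem_mk_right x y⟩
      have := hxy.1
      rw [Set.mem_symmDiff] at this
      rcases this with ⟨_, h⟩ | ⟨_, h⟩
      · exact h heB
      · exact h heN

end Lemmas

end Apex

section TheoremJ

variable {V : Type*} [Fintype V]

/-- **THEOREM J (prim-hp-2 gen 36): BIC({c}) for the apex of a spoked clique.**  `E` an edge set on a finite vertex type, `s` the source,
`c ≠ s` with `sc ∉ E`, every `E`-neighbour of `c` adjacent to `s`, and the `E`-neighbours of `c` pairwise adjacent.  Then for all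
increasing `F, G` of the edge cluster,
`0 ≤ Σ_{ω : c is not joined to s both in ω ∩ E and in ωᶜ ∩ E} (F(C_s(ω∩E)) − F(C_s(ωᶜ∩E))) · (G(C_s(ω∩E)) − G(C_s(ωᶜ∩E)))`. [this work] -/
theorem bic_cliqueApex_nonneg (E : Set (Sym2 V)) (s c : V) (hcs : c ≠ s) (hsc : s(s, c) ∉ E)
    (hN : ∀ u, s(c, u) ∈ E → u ≠ c → s(s, u) ∈ E)
    (hK : ∀ u v, s(c, u) ∈ E → s(c, v) ∈ E → u ≠ c → v ≠ c → u ≠ v → s(u, v) ∈ E)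
    {F G : Set (Sym2 V) → ℝ} (hF : Monotone F) (hG : Monotone G) :
    0 ≤ ∑ ω ∈ Finset.univ.filter (fun ω : Set (Sym2 V) =>
        ¬ ((openGraph (ω ∩ E)).Reachable s c ∧ (openGraph (ωᶜ ∩ E)).Reachable s c)),
      (F (openEdgeCluster (ω ∩ E) s) - F (openEdgeCluster (ωᶜ ∩ E) s)) *
        (G (openEdgeCluster (ω ∩ E) s) - G (openEdgeCluster (ωᶜ ∩ E) s)) := by
  have _ := hsc
  refine sum_nonneg_of_parts _ _ (Apex.partJ E s c) ?_ ?_ ?_ ?_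
  · intro T _
    exact Apex.mem_partJ_self
  · intro T hT M hM
    rw [Finset.mem_filter] at hT ⊢
    exact ⟨Finset.mem_univ _, Apex.mem_constraint_of_mem_partJ hcs hN hK hT.2 hM⟩
  · intro T hT M hM
    rw [Finset.mem_filter] at hT
    exact Apex.partJ_eq_of_mem hcs hN hK hT.2 hM
  · intro T hT
    rw [Finset.mem_filter] at hT
    exact Apex.partJ_sum_nonneg hcs hN hK hT.2 hF hG

end TheoremJ

end Antithetic

end Summit.CriticalPhenomena.PercolationContinuityZ3.Theorems
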